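import Mathlib
import Summits.Ventures.HodgeRepro2.T6A1Inputs
import Summits.Ventures.HodgeRepro2.T6A1Main
import Summits.Ventures.HodgeRepro2.T6A3Main
import Summits.Ventures.HodgeRepro2.T6N
import Summits.Ventures.HodgeRepro2.T6A3A2Inputs

/-!
# T6TheoremA — Theorem A on the interface: `(N) ⇒ the Weil classes of B are algebraic` (M1)

Cell pub-hodge-repro2, Tier 6 (README §10), seat t6-lead (gen 2). The M1 COMPOSITION CONTRACT
(STATUS l. 4494 / l. 4644; TARGET-T6 v0.4 §9.1): Theorem A over the interface `TransferShadow F`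
(`T6Interface`) is the composition, BY NAME, of the three owners' theorems — t6-p1's
`A1Inputs.A1_inputs_full` (the eigenbasis `E` of `H¹(B, ℂ)` with its eigenvectors `eK` and their
conjugate pairing, and the Weil projector `pW` with its three properties: TIER4 Theorem A1), t6-p2's
`A2_inputs` (the algebraic class `θ ∈ Alg 1` whose complexification is the model theta
`modelEquiv E (theta c)` with all `c_{i,ν} ≠ 0`: TIER4 (S2)), and t6-p3's `A3Main.A3_main` (the
detection argument: from `(N)` a non-zero Weil class is algebraic: TIER4 §A5–§A6), closed by t6-p1's
`A1Main.A1_lineHit` (one non-zero algebraic Weil class makes every Weil class algebraic, the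
Weil line being a single Hecke line). The period input `(N)` enters as `Hyp.PeriodN D` (`T6N`).

`theoremA_of_N_of_A2` takes the A2 handle as an explicit hypothesis (its type is the statement of
t6-p2's `A2_inputs`, l. 4587); `theoremA_of_N` (v2) is its instance at `A3A2Inputs.A2_inputs` —
t6-p2's `A2_inputs_sum` (read copy of 14:25Z, credited in that file) converted to the model form by
t6-p3's `A3Main.theta_eq_of_eigenBasis` (STATUS l. 5012 (3)).

§8(d): uses an L-value-free non-vanishing device: NO.
-/

namespace Summit.Ventures.HodgeRepro2.T6

open WeilPlanes WeilIntegral WeilDetect WeilCoproduct A3ExtBC A3BaseChange A3IntegralModel A3Detect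
  A3Model A3Pairing A3PairingKappa A3Main NumberField

variable {K : Type*} [Field K] [NumberField K]

/-- THEOREM A ON THE INTERFACE, modulo the A2 handle (the M1 composition, STATUS l. 4494): for a
Galois CM field `K` and a transfer shadow `D` of the face setting `F`, the period input `(N)` gives
the algebraicity of every Weil class of `B`. The A2 handle `hA2` is the statement of t6-p2's
`A2_inputs` (l. 4587): for the eigenbasis of A1 (conjugate-paired embedding coordinates, vectors
`single i (eK σ)` with `eK σ ≠ 0` spanning `K ⊗ ℂ`) there is an algebraic `θ ∈ Alg 1` with
`extC θ = modelEquiv E (theta c)` and every `c_p ≠ 0`. -/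
theorem theoremA_of_N_of_A2 [IsGalois ℚ K] [NumberField.IsCMField K] {F : FaceSetting K}
    (D : TransferShadow F)
    (hA2 : ∀ (E : EigenBasis K),
      (∀ ν : Fin 3, E.emb (ν, true) = ComplexEmbedding.conjugate (E.emb (ν, false))) →
      ∀ (eK : (K →+* ℂ) → KC K),
        (∀ (i : Fin 4) (σ : K →+* ℂ), E.eB (i, σ) = LinearMap.single ℂ (fun _ => KC K) i (eK σ)) →
        (∀ σ, eK σ ≠ 0) → Submodule.span ℂ (Set.range eK) = ⊤ →
        ∃ θ ∈ D.Alg 1, ∃ c : Pl → ℂ, (∀ p, c p ≠ 0) ∧ extC K θ = modelEquiv E (theta c))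
    (hN : Hyp.PeriodN D) : WeilClassesAlgebraic D := by
  obtain ⟨E, eK, pW, heB, hne, hspan, hconj, h1, h2, h3⟩ := A1Inputs.A1_inputs_full K D
  obtain ⟨θ, hθ, c, hc, hθC⟩ := hA2 E hconj eK heB hne hspan
  exact A1Main.A1_lineHit D (A3_main D E pW h1 h2 h3 θ hθ c hc hθC (periodInputN_of_hyp hN))

/-- THEOREM A ON THE INTERFACE (M1, STATUS l. 4494): for a Galois CM field `K` and a transfer shadow
`D` of the face setting `F`, the period input `(N)` gives the algebraicity of every Weil class of `B`
— `theoremA_of_N_of_A2` at the A2 handle `A3A2Inputs.A2_inputs` (A1 ∘ A2 ∘ A3 ∘ A1_lineHit, all by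
name). -/
theorem theoremA_of_N [IsGalois ℚ K] [NumberField.IsCMField K] {F : FaceSetting K}
    (D : TransferShadow F) (hN : Hyp.PeriodN D) : WeilClassesAlgebraic D :=
  theoremA_of_N_of_A2 D (fun E hconj eK heB hne hspan =>
    A3A2Inputs.A2_inputs D E hconj eK heB hne hspan) hN

end Summit.Ventures.HodgeRepro2.T6
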